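import Literature.Computability.QuantumComplexity.OracleGateReplacementBorn
import Literature.Computability.Learning.PAC
import Literature.Barriers.PneNP.RelativizedCircuitSizeCounting
import HarnessLib

/-!
# Aaronson–Chen 2017, Lemma 8.2: the PAC-learning replacement process

Support file for the named fact `Literature.Barriers.QuantumAdvantage.aaronsonChen2017_lem82`
(`PPolyOraclesProofs.lean`), which vendors, in the tree's models,

* S. Aaronson, L. Chen, *Complexity-theoretic foundations of quantum supremacy experiments*,
  CCC 2017 (arXiv:1612.05903) [AaronsonChen2017], **Lemma 8.2** (p. 32): "Suppose
  `SampBPP = SampBQP` and `NP ⊆ BPP`. Then for any polynomial `q(n)` and any `SampBQP` oracle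
  algorithm `M`, there is a `SampBPP` oracle algorithm `A` such that: For every
  `O ∈ SIZE(q(n))` … `‖𝒟^M_{x,ε} − 𝒟^A_{x,ε}‖ ≤ ε`."

**The printed proof** (pp. 32–33). `A` "replace[s] each oracle gate, one by one, by a known
function while minimizing the introduced error … here we use a more sophisticated PAC learning
subroutine to find an 'approximator' to replace the oracle gates": before the `t`-th `O`-gate
(an `f = O_{n_t}` gate), with `|v⟩` the state of the already-replaced circuit and `Q` the law of
its query register (`Q(i) = ⟨i|ρ|i⟩`), "we can take a `poly(n, ε₁⁻¹, ln δ₁⁻¹)` number of i.i.d.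
samples from `Q`, and then find a function `g` in `SIZE(q(n))` which agrees with `f` on those
samples. Then with probability at least `1 − δ₁`, we will have `Pr_{i∼Q}[f(i) ≠ g(i)] ≤ ε₁`"
(Occam's razor for the finite class of size-`q(n)` circuits), and
`‖(U_f − U_g) ⊗ I |v⟩‖² = 4·Pr_{i∼Q}[f(i) ≠ g(i)]` (eq. (13)); a union bound over the `T` gates
and the analysis of the final circuit `C_final` (unitary `V`) give, with probability `1 − T·δ₁`,
`‖U|0⟩ − V|0⟩‖ ≤ 2T√ε₁`; "`A` then simulates stages 2 and 3 of the `SampBQP` algorithm `M`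
straightforwardly. It first takes a sample `z` by measuring `V|0⟩^{⊗N}` … and then outputs
`A^output(z)`"; finally "the bad event costs its probability": `‖𝒟^A − 𝒟^M‖ ≤ ε`.

**What this file defines** — the IDEAL learner of this proof as a genuine random process in the
tree's Q2 model, on top of the landed deterministic replacement toolkit
(`OracleGateReplacement.lean`: `replMatrix g i gs`, `replQueryWeights`; `OracleGateReplacementBorn.lean`:
`queryMarginal`, `replKernel`):

* `AcLearn.SelRule`, `AcLearn.Admissible q sel` — a *selection rule* answers a labelled sample
  with a random hypothesis LANGUAGE; it is admissible for `q` when, whenever some language of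
  `SIZE(q)` is consistent with the sample, it returns only consistent languages of `SIZE(q)`
  ("find a function `g` in `SIZE(q(n))` which agrees with `f` on those samples" — ANY such rule;
  the Occam bound is uniform over consistent hypotheses). The rule is a parameter: the analysis
  (`AaronsonChenLearningAnalysis.lean`) holds for every admissible rule, and the machine fact
  (`PPolyOraclesLemma82.lean`) asserts that the `SampBPP` machine realises one that does not
  depend on the oracle.
* `AcLearn.process sel O m i gs ψ : PMF (ℕ → Language Bool)` — the law of the sequence of
  replacement languages `g_i, g_{i+1}, …` chosen along the gate list `gs` from the state `ψ`:
  at an oracle gate with query wires `e`, draw `m` i.i.d. samples from `Q = queryMarginal e ψ`,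
  label them by `O`, select `g`, continue in the state `U_g ψ` of the REPLACED run (the paper's
  `|v_{t+1}⟩`); gate symbols just act. Positions never met keep the value `O` (immaterial:
  `replMatrix`/`replQueryWeights` from counter `i` only read positions `≥ i` that are met,
  `replQueryWeights_congr`).
* `AcLearn.badSet O ε₁ i gs ψ` — the bad event "some replaced gate errs with `Q_t`-probability
  `> ε₁`", over the tree's `replQueryWeights` with the disagreement sets
  `AcLearn.disagree g O t = {w | [w ∈ g t] ≠ [w ∈ O]}`; its one-gate decomposition
  `mem_badSet_cons_oracle` drives the union bound.
* `AcLearn.learnLaw sel O m F post w` — the law of the learner's OUTPUT on input `w`: the mixture,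
  over the process, of the post-processed kernels `replKernel g F w` of the replaced circuits;
  `learnLaw_pure_self`: with the (inadmissibly informed) rule `pure O` it is the true kernel —
  the sanity check that the process threads the replaced-run states correctly.
* `AcLearn.hypClass q k` — the finite hypothesis class at query length `k`: the length-`k` slices
  (`AcLearn.hyp`) of languages of `SIZE(q)`, realised inside the functions computed by
  `B₂`-circuits of size `≤ q(k)` on `k` inputs, counted by Wilson's code
  (`PneNP.Wilson.card_computedFns_le`, imported from the `PneNP` catalogue support file where the
  tree's only circuit-counting lemma lives): `|hypClass q k| ≤ 2^{(k + q(k) + 3)(q(k) + 4)²}`, the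
  "`ln |H| = poly(n)`" behind "`poly(n, ε₁⁻¹, ln δ₁⁻¹)` samples".
* `AcLearn.budget c N T = (N + T + 2)^c` — the polynomial sample budget (per gate) in the number
  of wires `N` and of oracle gates `T`.

## Design notes

* Hypotheses are languages (`Language Bool`), as the replacement toolkit's `g t`; only the
  length-`k` slice of `g t` is ever queried by a `k`-wire oracle gate, and `Admissible` asks for
  membership of the whole language in `SIZE(q)` (equivalent data: a size-`q(k)` circuit at length
  `k` extends to such a language by any fixed member of `SIZE(q)` at the other lengths).
* Labels and consistency are phrased with `Set.boolIndicator` (`label`, `Consistent`), matching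
  the XOR query gate `oracleGate`, and the Occam interface (`Learning.IsConsistentOn`,
  `Learning.occamBadEvent` over `X = List Bool`, `Y = Bool`) through `AcLearn.hyp`.
* The selection rule sees the oracle-gate counter, the query width and the labelled sample — all
  the oracle-independent data a machine's subroutine may use; dependence on the input is added by
  the consumer (`PPolyOraclesLemma82.lean` indexes rules by the input word).

## Sources

* [AaronsonChen2017] arXiv:1612.05903, read via `lit read arxiv:1612.05903` (pp. 32–33): Lemma 8.2,
  its proof ("Replacing the `t`-th `O`-gate", eq. (13), "Upper bounding the deviation (13) via PAC
  learning", "Analysis of the final circuit `C_final`", "Showing that `A` is a `SampBPP` algorithm").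
* [Wilson1985] FACT p. 176 (counting small circuits), as proved in the tree
  (`Literature/Barriers/PneNP/RelativizedCircuitSizeCounting.lean`).
* [MohriRostamizadehTalwalkar2018] Thm. 2.5 (Occam's razor, finite class), as proved in the tree
  (`Literature/Computability/Learning/OccamFiniteProofs.lean`) — consumed by the sibling analysis file.
-/

noncomputable section

namespace Literature.Barriers.QuantumAdvantage

open _root_.Computability Literature.Computability.Complexity Literature.Computability.Cryptography
  Literature.Computability.QuantumComplexity Literature.Computability.Learning
open Matrix
open scoped ENNReal

variable {G : QGateSet} {N : ℕ}

namespace AcLearn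

/-! ### Hypotheses: length slices of languages and the finite class of small circuits -/

/-- The length-`k` slice of a language as a labelling function on all strings: `[w ∈ L]` on
strings of length `k`, `false` elsewhere (the hypothesis "`g : {0,1}^{n_t} → {0,1}`" of the `t`-th
replacement, read on the query strings of a `k`-wire oracle gate).
[cite: AaronsonChen2017, §8 (proof of Lemma 8.2, "replaced the t-th O-gate with a g_t gate, where g_t is a function from {0,1}^{n_t} to {0,1}", p. 33)] -/
def hyp (L : Language Bool) (k : ℕ) : List Bool → Bool :=
  fun w => if w.length = k then L.boolIndicator w else false

/-- A Boolean function on `k` bits as a labelling function on all strings (`false` off length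
`k`). [folklore] -/
def extendFn (k : ℕ) (f : (Fin k → Bool) → Bool) : List Bool → Bool :=
  fun w => if h : w.length = k then f (fun i => w.get (i.cast h.symm)) else false

open scoped Classical in
/-- **The finite hypothesis class at query length `k`**: the labelling functions of the Boolean
functions on `k` bits computed by `B₂`-circuits of size at most `q(k)` ("a function `g` in
`SIZE(q(n))`"), via Wilson's finite set `computedFns` (oracle `∅`, fan-in-charged size = size
over `B₂`). [cite: AaronsonChen2017, §8 (proof of Lemma 8.2, "find a function g in SIZE(q(n))", p. 33)] -/
def hypClass (q : Polynomial ℕ) (k : ℕ) : Finset (List Bool → Bool) :=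
  (PneNP.Wilson.computedFns (0 : Language Bool) k (q.eval k)).image (extendFn k)

/-- **`ln |H|` is polynomial**: `|hypClass q k| ≤ 2^{(k + q(k) + 3)(q(k) + 4)²}` (Wilson's count
of circuits of size `≤ q(k)` on `k` inputs). [cite: Wilson1985, FACT p. 176] -/
theorem card_hypClass_le (q : Polynomial ℕ) (k : ℕ) :
    (hypClass q k).card ≤ 2 ^ ((k + q.eval k + 3) * (q.eval k + 4) ^ 2) := by
  classical
  unfold hypClass
  exact Finset.card_image_le.trans (PneNP.Wilson.card_computedFns_le _ _ _)

/-- Transport of circuit evaluation along `|w| = n`. [folklore] -/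
theorem eval_get_cast (C : CircuitFamily) (w : List Bool) {n : ℕ} (h : w.length = n) :
    (C n).eval (fun i => w.get (i.cast h.symm)) = (C w.length).eval w.get := by
  subst h
  rfl

/-- The slice of a language of `SIZE(q)` lies in the hypothesis class (its `k`-th circuit computes
it). [cite: AaronsonChen2017, §8 (proof of Lemma 8.2, p. 33)] -/
theorem hyp_mem_hypClass {q : Polynomial ℕ} {L : Language Bool}
    (hL : L ∈ SIZE (fun n => q.eval n)) (k : ℕ) : hyp L k ∈ hypClass q k := by
  classical
  obtain ⟨C, hC, hdec⟩ := hL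
  refine Finset.mem_image.2
    ⟨(C k).eval, PneNP.Wilson.mem_computedFns.2 ⟨C k, ⟨?_, ?_⟩, fun v => rfl⟩, ?_⟩
  · exact (hC k).1.mono Set.subset_union_left
  · rw [PneNP.sizeWith_oracleGateCost_of_isOver_B2 (hC k).1]
    exact (hC k).2
  · funext w
    unfold extendFn hyp
    by_cases h : w.length = k
    · rw [dif_pos h, if_pos h, eval_get_cast C w h, hdec w]
    · rw [dif_neg h, if_neg h]

/-! ### Labelled samples, selection rules -/

/-- A **selection rule**: given the oracle-gate counter, the query width and a labelled sample,
a random hypothesis language ("find a function `g` … which agrees with `f` on those samples";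
randomised, as a `BPP` search procedure is). [cite: AaronsonChen2017, §8 (proof of Lemma 8.2, "Finding a g ∈ SIZE(q(n)) such that g agrees with f on all the samples. This can be done in NP", p. 33)] -/
abbrev SelRule : Type := ℕ → ℕ → List (List Bool × Bool) → PMF (Language Bool)

/-- The sample labelled by the oracle: `(w, [w ∈ O])` (the machine queries `O` on its samples).
[cite: AaronsonChen2017, §8 (proof of Lemma 8.2, "which agrees with f on those samples", p. 33)] -/
def label (O : Language Bool) (S : List (List Bool)) : List (List Bool × Bool) :=
  S.map fun w => (w, O.boolIndicator w)

/-- `g` is consistent with a labelled sample. [cite: AaronsonChen2017, §8 (proof of Lemma 8.2, p. 33)] -/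
def Consistent (g : Language Bool) (S : List (List Bool × Bool)) : Prop :=
  ∀ p ∈ S, g.boolIndicator p.1 = p.2

/-- The oracle is consistent with the sample it labels. [folklore] -/
theorem consistent_label (O : Language Bool) (S : List (List Bool)) : Consistent O (label O S) := by
  intro p hp
  obtain ⟨w, -, rfl⟩ := List.mem_map.1 hp
  rfl

/-- Consistency with an `O`-labelled sample is agreement with `O` on the sample points. [folklore] -/
theorem consistent_label_iff (g O : Language Bool) (S : List (List Bool)) :
    Consistent g (label O S) ↔ ∀ w ∈ S, g.boolIndicator w = O.boolIndicator w := by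
  refine ⟨fun h w hw => h (w, O.boolIndicator w) (List.mem_map.2 ⟨w, hw, rfl⟩), fun h p hp => ?_⟩
  obtain ⟨w, hw, rfl⟩ := List.mem_map.1 hp
  exact h w hw

/-- **Admissible selection rules for `SIZE(q)`**: whenever some language of `SIZE(q)` is
consistent with the labelled sample, the rule returns (with probability one) a consistent
language of `SIZE(q)` — the only property of "find a `g ∈ SIZE(q(n))` which agrees with `f` on
all the samples" that the analysis uses. [cite: AaronsonChen2017, §8 (proof of Lemma 8.2, p. 33)] -/
def Admissible (q : Polynomial ℕ) (sel : SelRule) : Prop :=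
  ∀ (i k : ℕ) (S : List (List Bool × Bool)),
    (∃ L ∈ SIZE (fun n => q.eval n), Consistent L S) →
      ∀ g ∈ (sel i k S).support, g ∈ SIZE (fun n => q.eval n) ∧ Consistent g S

/-! ### The learning process -/

/-- **The PAC-learning replacement process** of the proof of Lemma 8.2, as the law of the sequence
of replacement languages (indexed by the oracle-gate counter, started at `i`) chosen along the
gate list `gs` from the state `ψ`, against the oracle `O`, with `m` samples per gate and the
selection rule `sel`: a gate symbol acts on the state; at an oracle gate with `k` query wires
placed by `e` the process draws `m` i.i.d. samples from the query-register law
`Q = queryMarginal e ψ` of the CURRENT (replaced-run) state, labels them by `O`, selects `g`, sets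
position `i` of the sequence to `g`, and continues from the replaced-run state `U_g ψ` with
counter `i + 1` ("Suppose we have already replaced the first `t − 1` `O`-gates … `|v⟩` … is the
quantum state right before the `t`-th `O` gate in the circuit after the replacement"). Positions
of the sequence that are never met keep the value `O`. [cite: AaronsonChen2017, §8 (proof of Lemma 8.2, "Replacing the t-th O-gate" and "Upper bounding the deviation (13) via PAC learning", pp. 32–33)] -/
def process (sel : SelRule) (O : Language Bool) (m : ℕ) :
    ℕ → List (QGate G N) → (QReg N → ℂ) → PMF (ℕ → Language Bool)
  | _, [], _ => PMF.pure fun _ => O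
  | i, QGate.gate s e :: gs, ψ => process sel O m i gs (placeGate e (G.mat s) *ᵥ ψ)
  | i, QGate.oracle k e :: gs, ψ =>
      (iidList (queryMarginal e ψ) m).bind fun S =>
        (sel i k (label O S)).bind fun g =>
          (process sel O m (i + 1) gs (placeGate e (oracleGate g k) *ᵥ ψ)).map
            fun rest => Function.update rest i g

/-- The process on the empty gate list (definitional). [folklore] -/
@[simp] theorem process_nil (sel : SelRule) (O : Language Bool) (m i : ℕ) (ψ : QReg N → ℂ) :
    process (G := G) sel O m i [] ψ = PMF.pure fun _ => O := rfl

/-- The process at a gate symbol (definitional). [folklore] -/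
@[simp] theorem process_cons_gate (sel : SelRule) (O : Language Bool) (m i : ℕ) (s : G.Op)
    (e : Fin (G.arity s) ↪ Fin N) (gs : List (QGate G N)) (ψ : QReg N → ℂ) :
    process sel O m i (QGate.gate s e :: gs) ψ = process sel O m i gs (placeGate e (G.mat s) *ᵥ ψ) :=
  rfl

/-- The process at an oracle gate (definitional). [folklore] -/
theorem process_cons_oracle (sel : SelRule) (O : Language Bool) (m i k : ℕ)
    (e : Fin (k + 1) ↪ Fin N) (gs : List (QGate G N)) (ψ : QReg N → ℂ) :
    process sel O m i (QGate.oracle k e :: gs) ψ =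
      (iidList (queryMarginal e ψ) m).bind fun S =>
        (sel i k (label O S)).bind fun g =>
          (process sel O m (i + 1) gs (placeGate e (oracleGate g k) *ᵥ ψ)).map
            fun rest => Function.update rest i g := rfl

/-! ### Disagreement sets and the bad event -/

/-- The disagreement set `{w | [w ∈ g] ≠ [w ∈ O]}` of a replacement with the oracle
(Aaronson–Chen's `[f(i) ≠ g(i)]`). [cite: AaronsonChen2017, §8 (proof of Lemma 8.2, eq. (13), p. 32)] -/
def disagree₁ (g O : Language Bool) : Set (List Bool) :=
  {w | g.boolIndicator w ≠ O.boolIndicator w}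

/-- The disagreement sets along a sequence of replacements. [cite: AaronsonChen2017, §8 (proof of Lemma 8.2, eq. (13), p. 32)] -/
def disagree (g : ℕ → Language Bool) (O : Language Bool) (t : ℕ) : Set (List Bool) :=
  disagree₁ (g t) O

/-- Unfolding of `disagree` (definitional). [folklore] -/
@[simp] theorem disagree_apply (g : ℕ → Language Bool) (O : Language Bool) (t : ℕ) :
    disagree g O t = disagree₁ (g t) O := rfl

/-- Off its disagreement set a replacement agrees with the oracle (the hypothesis `hD` of the
replacement toolkit). [folklore] -/
theorem iff_of_notMem_disagree (g : ℕ → Language Bool) (O : Language Bool) (t : ℕ) (w : List Bool)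
    (hw : w ∉ disagree g O t) : w ∈ g t ↔ w ∈ O := by
  simp only [disagree, disagree₁, Set.mem_setOf_eq, ne_eq, not_not] at hw
  constructor
  · intro h
    have h' := (Set.mem_iff_boolIndicator (g t) w).1 h
    rw [hw] at h'
    exact (Set.mem_iff_boolIndicator O w).2 h'
  · intro h
    have h' := (Set.mem_iff_boolIndicator O w).1 h
    rw [← hw] at h'
    exact (Set.mem_iff_boolIndicator (g t) w).2 h'

/-- Setting position `i` does not change later positions. [folklore] -/
theorem update_apply_of_lt (rest : ℕ → Language Bool) (g : Language Bool) {i t : ℕ} (ht : i < t) :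
    Function.update rest i g t = rest t := by
  rw [Function.update_apply, if_neg (Nat.ne_of_gt ht)]

/-- The value set at position `i`. [folklore] -/
theorem update_apply_self (rest : ℕ → Language Bool) (g : Language Bool) (i : ℕ) :
    Function.update rest i g i = g := by
  rw [Function.update_apply, if_pos rfl]

/-- **The bad event**: some oracle gate of `gs` (counter from `i`, state `ψ`) is replaced by a
language whose disagreement set has query magnitude — `Q_t`-probability — above `ε₁` along the
replaced run (the complement of "for all `t`, `Pr_{i∼Q_t}[f(i) ≠ g_t(i)] ≤ ε₁`").
[cite: AaronsonChen2017, §8 (proof of Lemma 8.2, "with probability at least 1 − δ₁, we will have Pr_{i∼Q}[f(i) ≠ g(i)] ≤ ε₁" and the union bound, p. 33)] -/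
def badSet (O : Language Bool) (ε₁ : ℝ) (i : ℕ) (gs : List (QGate G N)) (ψ : QReg N → ℂ) :
    Set (ℕ → Language Bool) :=
  {g | ∃ w ∈ replQueryWeights g (disagree g O) i gs ψ, ε₁ < w}

/-- Outside the bad event every replaced gate errs with query magnitude at most `ε₁` (the
hypothesis `hε` of the replacement toolkit's uniform bounds). [folklore] -/
theorem not_mem_badSet_iff (O : Language Bool) (ε₁ : ℝ) (i : ℕ) (gs : List (QGate G N))
    (ψ : QReg N → ℂ) (g : ℕ → Language Bool) :
    g ∉ badSet O ε₁ i gs ψ ↔ ∀ w ∈ replQueryWeights g (disagree g O) i gs ψ, w ≤ ε₁ := by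
  simp [badSet]

/-- The oracle-gate counter does not decrease. [folklore] -/
theorem le_nextIdx (x : QGate G N) (i : ℕ) : i ≤ x.nextIdx i := by
  cases x <;> simp [QGate.nextIdx]

/-- `replQueryWeights` from counter `i` only reads the sequences at positions `≥ i`. [folklore] -/
theorem replQueryWeights_congr {g g' : ℕ → Language Bool} {D D' : ℕ → Set (List Bool)} :
    ∀ (i : ℕ) (gs : List (QGate G N)) (ψ : QReg N → ℂ), (∀ t, i ≤ t → g t = g' t) →
      (∀ t, i ≤ t → D t = D' t) →
        replQueryWeights g D i gs ψ = replQueryWeights g' D' i gs ψ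
  | _, [], _, _, _ => rfl
  | i, x :: gs, ψ, hg, hD => by
    rw [replQueryWeights_cons, replQueryWeights_cons, hg i le_rfl, hD i le_rfl,
      replQueryWeights_congr (x.nextIdx i) gs _ (fun t ht => hg t ((le_nextIdx x i).trans ht))
        (fun t ht => hD t ((le_nextIdx x i).trans ht))]

/-- `replMatrix` from counter `i` only reads the sequence at positions `≥ i`. [folklore] -/
theorem replMatrix_congr {g g' : ℕ → Language Bool} :
    ∀ (i : ℕ) (gs : List (QGate G N)), (∀ t, i ≤ t → g t = g' t) →
      replMatrix g i gs = replMatrix g' i gs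
  | _, [], _ => rfl
  | i, x :: gs, hg => by
    rw [replMatrix_cons, replMatrix_cons, hg i le_rfl,
      replMatrix_congr (x.nextIdx i) gs (fun t ht => hg t ((le_nextIdx x i).trans ht))]

/-- A gate symbol contributes no error term: the bad event passes to the next state. [folklore] -/
theorem badSet_cons_gate (O : Language Bool) (ε₁ : ℝ) (i : ℕ) (s : G.Op)
    (e : Fin (G.arity s) ↪ Fin N) (gs : List (QGate G N)) (ψ : QReg N → ℂ) :
    badSet O ε₁ i (QGate.gate s e :: gs) ψ = badSet O ε₁ i gs (placeGate e (G.mat s) *ᵥ ψ) := by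
  ext g
  simp [badSet, replQueryWeights_cons, QGate.queryWeights, QGate.nextIdx]

/-- **One step of the union bound**: if the sequence `g` at position `i` followed by `rest` is
bad at an oracle gate, then either `g` itself errs with query magnitude `> ε₁` in the current
state, or `rest` is bad from the replaced-run state `U_g ψ` on.
[cite: AaronsonChen2017, §8 (proof of Lemma 8.2, "by a union bound over all rounds", p. 33)] -/
theorem mem_badSet_cons_oracle {O : Language Bool} {ε₁ : ℝ} {i k : ℕ} {e : Fin (k + 1) ↪ Fin N}
    {gs : List (QGate G N)} {ψ : QReg N → ℂ} {rest : ℕ → Language Bool} {g : Language Bool}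
    (h : Function.update rest i g ∈ badSet O ε₁ i (QGate.oracle k e :: gs) ψ) :
    ε₁ < queryWeight (disagree₁ g O) e ψ ∨
      rest ∈ badSet O ε₁ (i + 1) gs (placeGate e (oracleGate g k) *ᵥ ψ) := by
  obtain ⟨w, hw, hlt⟩ := h
  rw [replQueryWeights_cons, List.mem_append] at hw
  have hi : Function.update rest i g i = g := update_apply_self rest g i
  rcases hw with hw | hw
  · left
    simp only [QGate.queryWeights, List.mem_singleton] at hw
    rw [hw, disagree_apply, hi] at hlt
    exact hlt
  · right
    refine ⟨w, ?_, hlt⟩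
    rw [QGate.nextIdx_oracle, QGate.toMatrix_oracle, hi,
      replQueryWeights_congr (g' := rest) (D' := disagree rest O) (i + 1) gs _
        (fun t ht => update_apply_of_lt rest g ht)
        (fun t ht => by rw [disagree_apply, disagree_apply, update_apply_of_lt rest g ht])] at hw
    exact hw

/-! ### The law of the learner's output; the sample budget -/

/-- **The law of the ideal learner's output** on input `w` (family `F`, post-processing `post`,
oracle `O`, `m` samples per gate, rule `sel`): run the process on the circuit `F.circ |w|` from
`|w⟩|0…0⟩`, then output a post-processed sample of the replaced circuit's measurement — the
mixture over the process of the kernels `replKernel g F w` ("It first takes a sample `z` by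
measuring `V|0⟩^{⊗N}` in the computational basis, and then outputs `A^output(z)` as its
sample"). [cite: AaronsonChen2017, §8 (proof of Lemma 8.2, "Our classical algorithm A then simulates stages 2 and 3", p. 33)] -/
def learnLaw (sel : SelRule) (O : Language Bool) (m : ℕ) (F : QCircuitFamily G)
    (post : List Bool → List Bool) (w : List Bool) : PMF (List Bool) :=
  (process sel O m 0 (F.circ w.length).gates
      (basisState (padInput w.get (F.ancillas w.length)))).bind
    fun g => (replKernel g F w).map post

/-- Sanity check: with the (oracle-informed, hence useless to a machine) rule "always answer `O`"
the process returns the constant sequence `O`. [folklore] -/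
theorem process_pure_self (O : Language Bool) (m : ℕ) :
    ∀ (i : ℕ) (gs : List (QGate G N)) (ψ : QReg N → ℂ),
      process (fun _ _ _ => PMF.pure O) O m i gs ψ = PMF.pure fun _ => O
  | _, [], _ => rfl
  | i, QGate.gate s e :: gs, ψ => by
    rw [process_cons_gate, process_pure_self O m i gs]
  | i, QGate.oracle k e :: gs, ψ => by
    rw [process_cons_oracle]
    simp only [PMF.pure_bind, process_pure_self O m (i + 1) gs, PMF.pure_map, PMF.bind_const]
    congr 1
    exact Function.update_eq_self i fun _ : ℕ => O

/-- Sanity check: with the rule "always answer `O`" the learner's law is the true post-processed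
kernel `𝒟^M` (`replOutputPMF_const`): the process threads exactly the replaced-run states.
[folklore] -/
theorem learnLaw_pure_self (O : Language Bool) (m : ℕ) (F : QCircuitFamily G)
    (post : List Bool → List Bool) (w : List Bool) :
    learnLaw (fun _ _ _ => PMF.pure O) O m F post w = (F.kernel O w).map post := by
  rw [learnLaw, process_pure_self, PMF.pure_bind, replKernel, replOutputPMF_const]
  rfl

/-- **The sample budget** `(N + T + 2)^c` per oracle gate, polynomial in the number `N` of wires
and `T` of oracle gates ("a `poly(n, ε₁⁻¹, ln δ₁⁻¹)` number of i.i.d. samples", with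
`δ₁ = ε/2T`, `ε₁ = ε⁴/256T²` polynomial); the exponent `c` is fixed by the analysis.
[cite: AaronsonChen2017, §8 (proof of Lemma 8.2, p. 33)] -/
def budget (c N T : ℕ) : ℕ := (N + T + 2) ^ c

end AcLearn

end Literature.Barriers.QuantumAdvantage

end
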